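import Summits.BirchSwinnertonDyer.BirchSwinnertonDyer.Theorems.TameQuarticManinParityTwistLatticeSandwich
import Summits.BirchSwinnertonDyer.BirchSwinnertonDyer.Theorems.TameQuarticManinParityTwistPairManinDivisibilityOfSandwich
import HarnessLib

/-!
# Route `TameQuarticManinParity`, LINE 25 (bsd-idea-3 g8): M25 `TprimeIrrTwistPairManinDivisibility` (stmt-22695)
# ⟸ T24L `TprimeIrrOptimalTwistNeronLattice` (stmt-22694) ALONE, by name (`--supports` 22695)

Cell `pub/bsd-wall`, D-0145 line `route-BirchSwinnertonDyer-TeichmullerTwistDescent`, seat `bsd-line-ttd-p1` g10.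
BSD is NOT proved by this; Manin's conjecture is not proved by this; M25 and T24L remain OPEN. With S25
(`tprimeTwistLatticeSandwich_proof`, landed outright) and the glue GM25
(`tprimeIrrTwistPairManinDivisibilityOfSandwich_proof`), the twist-pair Manin divisibilities
`c_{III*} ∣ c_{III} ∣ 3·c_{III*}` reduce BY NAME to the single open input T24L («twist of optimal is optimal» on the
irreducible (t′) pairs). Design: one composition; no definition, no named fact, no `sorry`.
-/

set_option autoImplicit false
-- D-0017: single-problem summit, so `Summit.BirchSwinnertonDyer.BirchSwinnertonDyer.…` repeats a namespace BY DESIGN.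
set_option linter.dupNamespace false

namespace Summit.BirchSwinnertonDyer.BirchSwinnertonDyer.Theorems.TameQuarticManinParity

open Summit.BirchSwinnertonDyer.BirchSwinnertonDyer.Theses.TameQuarticManinParity

/-- **M25 from T24L alone**: `TprimeIrrOptimalTwistNeronLattice → TprimeIrrTwistPairManinDivisibility`
(GM25 ∘ S25, both landed). [cite: Stevens1989, Lemmas (5.2), (5.4)] -/
theorem tprimeIrrTwistPairManinDivisibility_of_optimalTwistNeronLattice (hT : TprimeIrrOptimalTwistNeronLattice) :
    TprimeIrrTwistPairManinDivisibility :=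
  tprimeIrrTwistPairManinDivisibilityOfSandwich_proof tprimeTwistLatticeSandwich_proof hT

end Summit.BirchSwinnertonDyer.BirchSwinnertonDyer.Theorems.TameQuarticManinParity
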